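/-
Copyright (c) 2026 the pub-hodgecm-mathlib formalisation cell (harness21).  Prover seat hodgecm-mathlib-LH4-p14 (g4): Track A «(D-RAM) FOUR-FRAME» squad of crux H413, unit U2H (ii-H),
(ρ2b′-X) payer of record (heir) — THE FINITENESS ∕ WEIGHT ∕ CUT-OFF ORGANS the (C1) block census consumes (`hfinF`∕`hWfin`, `f`+`hf`, `hJ` of ★ p857559), in the abstract
E∕M letters of ★ (C) `ncard_selfDual_fixed_eq_ncard_orderLatt` and ★ W4 `setOf_orderLatt_selfDual_eq_iUnion`; payer MAP v2 bde9a80f (C0b-1½ organs), 2026-09-04.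
-/
import Summits.HodgeConjecture.HodgeConjecture.Theorems.F0P3cDyRamBlockCensusOrderForm     -- ★ (C1) p857559 (LH4-p11 (g5)): brings ★ W4 p857271, ★ p12 `ncard_glueFibre_eq_natCard_normFibre_of_gen`, DEFS
import Literature.NumberTheory.Automorphic.EllipticPlaneAsFieldLineDictionary               -- ★ `exists_latt_map_eq_of_order`, `exists_eq_mul_order_map_latt`, `mapGL_eq_iff_forall_mul_mem`
import Literature.NumberTheory.Automorphic.UnitaryLatticeTreeApartment                      -- ★ `dualLatt_eq_self_of_isSelfDualLattice`
import Mathlib.GroupTheory.ArchimedeanDensely                                               -- `exists_pow_lt₀`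
import HarnessLib

/-!
# F0 · P3c · line LH4 «(D-RAM) FOUR-FRAME» — unit (ii-H), leaf (ρ2b′-X): THE FINITENESS, WEIGHT AND CUT-OFF ORGANS OF THE BLOCK CENSUS
(Kottwitz 1986 §1; Jacobowitz 1962 §4, §7; Bruhat–Tits 1972 §10)

Cell `pub/hodgecm-mathlib`, crux H413 = `stmt-HodgeConjecture-24833` (helper lane, count-neutral); THEOREMS ONLY (no definition, no instance, no notation, no named fact, no `sorry`,
default heartbeats); DATUM-FREE (abstract valued fields `E` = the plane's field and `M` = the line model).  These are the four side letters of ★ (C1) p857559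
`ncard_fixed_selfDual_endoGL_eq_orderForm` ∕ ★ (β) p857610 that are NOT census content, discharged once for every instance (socket (C″⁺) → (C″) of the payer chain, LH4-p11 (g5)
2026-09-04T05:46:35Z ∕ payer 05:51:39Z):

* §1 `finite_setOf_orderLatt_selfDual` — the `lam`-stable hermitian-self-dual ORDER LATTICES of `M` are finitely many, given finite level-`0` sets and a conductor cut-off
  `lam ∉ 𝒪_{ϖE^{J+1}}` (★ W4a `setOf_orderLatt_selfDual_eq_iUnion` + ★ `not_isOrd_pow_of_lt`: the union truncates at `J`);
* §2 `finite_setOf_selfDual_mapGL_of_orderLatt` — the `γ₂`-FIXED SELF-DUAL PLANE LATTICES are finitely many whenever the order-lattice family is: the transport map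
  `B ↦ φ(B)` of ★ (C) is injective INTO it (the «into» half of ★ `ncard_selfDual_fixed_eq_ncard_orderLatt`, by name) — the `hWfin` letter of ★ THM A′
  `finite_setOf_selfDual_mapGL_endoGL_eq_of_det_ne_zero`;
* §3 `exists_weight` — a CHOICE-FREE WEIGHT `f : ℕ → ℕ → AddSubgroup M → ℕ` agreeing with the norm-residue count `Nat.card Sol_{2b}(r)` on every presented cone cell (the `hf`
  letter of ★ (C1) ∕ ★ (β), VERBATIM with `u : E`): `f b j Λ :=` the glue-fibre count of (a choice of) the `φ`-preimage lattice of `Λ` (`0` if none) — well defined and equal to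
  `Nat.card Sol_{2b}(r)` for EVERY presentation `(x₀, r)` by ★ `ncard_glueFibre_eq_natCard_normFibre_of_gen` (LH4-p12 (g4)) and ★ `exists_latt_map_eq_of_order`;
* §4 `exists_not_isOrd_pow` — the CONDUCTOR CUT-OFF: if `ρ lam ≠ lam` and `|c| < 1` then `lam ∉ 𝒪_{c^{J+1}}` for some `J` (archimedean property of `ℤᵐ⁰`).

HONEST LABEL: HC_CM is proved only modulo the 7 printed citations (2 remaining named inputs: hLiu418 = stmt-HodgeConjecture-24832, h413 = stmt-HodgeConjecture-24833) until rung 0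
closes; this file is count-neutral lattice bookkeeping — nothing printed is asserted; (ρ2b′-X) stays OPEN.  The one finiteness letter NOT discharged here is (S1)
`(levelSet ρ Θ α ϖE h j a).Finite` (taken as `hfin`; T5 sheet (S1), LH4-p08∕p04).

## References
* [Kottwitz1986BaseChangeUnits] R. E. Kottwitz, *Base change for unit elements of Hecke algebras*, Compositio Math. 60 (1986), §1 pp. 240–241 (orbital integrals of units as
  finite fixed-lattice counts).
* [Jacobowitz1962] R. Jacobowitz, *Hermitian forms over local fields*, Amer. J. Math. 84 (1962), §4 (dual lattices, gluing), §7.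
* [BruhatTits1972] F. Bruhat, J. Tits, *Groupes réductifs sur un corps local I*, Publ. Math. IHÉS 41 (1972), §10 (lattice models; tube layers).
-/

set_option autoImplicit false

noncomputable section

open scoped Valued WithZero Matrix MatrixGroups
open WithZero
open scoped Classical
open Literature.NumberTheory.Automorphic Literature.NumberTheory.Automorphic.HermitianLattice Literature.NumberTheory.Automorphic.UnitaryLatticeTree
open Literature.NumberTheory.Automorphic.EllipticPlaneAsFieldLine
open Literature.NumberTheory.LocalFields.QuadraticOrder
open Summit.HodgeConjecture.HodgeConjecture.Cruxes.H413.F0P3cDyRamToricCensusDefs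
open Summit.HodgeConjecture.HodgeConjecture.Cruxes.H413.F0P3cDyRamWSideOrderCensus
open Summit.HodgeConjecture.HodgeConjecture.Cruxes.H413.F0P3cDyRamConeLevelTransport

namespace Summit.HodgeConjecture.HodgeConjecture.Cruxes.H413.F0P3cDyRamFixedPointCensusTypeTwoFiniteness

variable {E M : Type*} [Field E] [Valued E ℤᵐ⁰] [Field M] [Valued M ℤᵐ⁰] {ρ Θ : M →+* M} {α : M}

/-! ## §1 Finiteness of the `lam`-stable self-dual order lattices (M-letters) -/

/-- **§1 FINITENESS OF THE `lam`-STABLE SELF-DUAL ORDER LATTICES.**  With the frame `(ρ, Θ, α)` of `M`, a fixed non-unit `ϖE ≠ 0` measuring every fixed integral value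
(`hEval`), `h ≠ 0`, finite level-`0` sets `levelSet(j, 0)` and the cut-off `lam ∉ 𝒪_{ϖE^{J+1}}`, the family
`{Λ ∣ Λ = z·𝒪_c, lam·Λ ⊆ Λ, Λ = Λ^#}` is FINITE: by ★ W4a it is `⋃_j {Λ ∈ levelSet(j,0) ∣ lam ∈ 𝒪_{ϖE^j}}`, empty for `j > J` (★ `not_isOrd_pow_of_lt`).
[cite: Kottwitz1986BaseChangeUnits, §1 pp. 240–241] [cite: Jacobowitz1962, §7] -/
theorem finite_setOf_orderLatt_selfDual (hρρ : ∀ x, ρ (ρ x) = x) (hvρ : ∀ x, Valued.v (ρ x) = Valued.v x) (hα : ρ α ≠ α) (hα1 : Valued.v α ≤ 1)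
    (hint : ∀ z : M, Valued.v z ≤ 1 → Valued.v ((z - ρ z) / (α - ρ α)) ≤ 1)
    (hΘΘ : ∀ x, Θ (Θ x) = x) (hΘρ : ∀ x, Θ (ρ x) = ρ (Θ x)) (hvΘ : ∀ x, Valued.v (Θ x) = Valued.v x)
    {ϖE : M} (hρϖ : ρ ϖE = ϖE) (hϖ0 : ϖE ≠ 0) (hϖ1 : Valued.v ϖE < 1)
    (hEval : ∀ c : M, ρ c = c → c ≠ 0 → Valued.v c ≤ 1 → ∃ n : ℕ, Valued.v c = Valued.v ϖE ^ n)
    {h : M} (hh : h ≠ 0) (lam : M) {J : ℕ} (hJ : ¬ IsOrd ρ α (ϖE ^ (J + 1)) lam) (hfin : ∀ j, (levelSet ρ Θ α ϖE h j 0).Finite) :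
    {Λ : AddSubgroup M | (∃ z c : M, z ≠ 0 ∧ ρ c = c ∧ c ≠ 0 ∧ Valued.v c ≤ 1 ∧ ∀ x, x ∈ Λ ↔ ∃ y, IsOrd ρ α c y ∧ x = z * y) ∧
        (∀ x ∈ Λ, lam * x ∈ Λ) ∧ (∀ m, (∀ a ∈ Λ, Valued.v (h * Θ a * m + ρ (h * Θ a * m)) ≤ 1) ↔ m ∈ Λ)}.Finite := by
  rw [setOf_orderLatt_selfDual_eq_iUnion hρρ hvρ hα hα1 hint hΘΘ hΘρ hvΘ hρϖ hϖ0 hϖ1 hEval hh lam]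
  refine ((Finset.range (J + 1)).finite_toSet.biUnion fun j _ => hfin j).subset ?_
  intro Λ hΛ
  simp only [Set.mem_iUnion, Set.mem_setOf_eq] at hΛ
  obtain ⟨j, hΛj, hlam⟩ := hΛ
  simp only [Set.mem_iUnion, Finset.coe_range, Set.mem_Iio, exists_prop]
  refine ⟨j, ?_, hΛj⟩
  by_contra hjJ
  exact not_isOrd_pow_of_lt hϖ1.le hJ (by omega) hlam

/-! ## §2 Finiteness of the fixed self-dual plane lattices (transport to M) -/

/-- **§2 FINITENESS OF THE `γ₂`-FIXED SELF-DUAL PLANE LATTICES, BY TRANSPORT.**  In the letters of ★ (C) `ncard_selfDual_fixed_eq_ncard_orderLatt` (line model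
`φ : E² → M`, `φ(γ₂ x) = lam·φ x`, `jE⟨x, y⟩_{H₂} = Tr(h·Θ(φx)·φy)`), if the `lam`-stable self-dual order lattices of `M` are finitely many then so are
`{B ∣ B self-dual for H₂, γ₂·B = B}`: `B ↦ φ(B)` is injective (★ `map_toAddSubgroup_injective`) and lands in that family (★ `exists_eq_mul_order_map_latt`,
★ `mapGL_eq_iff_forall_mul_mem`, ★ `forall_herm_iff_mem_of_dualLatt_eq`, ★ `dualLatt_eq_self_of_isSelfDualLattice`).  This is the `hWfin` letter of ★ THM A′.
[cite: Kottwitz1986BaseChangeUnits, §1 pp. 240–241] [cite: Jacobowitz1962, §4] -/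
theorem finite_setOf_selfDual_mapGL_of_orderLatt (σ : E →+* E) (hvσ : ∀ a, Valued.v (σ a) = Valued.v a) {ϖ : E}
    {H₂ : Matrix (Fin 2) (Fin 2) E} (hH₂ : IsUnit H₂.det) (jE : E →+* M)
    (hρρ : ∀ x, ρ (ρ x) = x) (hvρ : ∀ x, Valued.v (ρ x) = Valued.v x) (hα : ρ α ≠ α) (hα1 : Valued.v α ≤ 1)
    (hint : ∀ z : M, Valued.v z ≤ 1 → Valued.v ((z - ρ z) / (α - ρ α)) ≤ 1)
    (hjv : ∀ c, Valued.v (jE c) ≤ 1 ↔ Valued.v c ≤ 1) (hjfix : ∀ z, ρ z = z ↔ ∃ c, jE c = z)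
    (φ : (Fin 2 → E) →+ M) (hφs : ∀ (c : E) (x : Fin 2 → E), φ (c • x) = jE c * φ x) (hφi : Function.Injective φ) (hφo : Function.Surjective φ)
    {γ₂ : GL (Fin 2) E} {lam h : M} (hφγ : ∀ x, φ ((γ₂ : Matrix (Fin 2) (Fin 2) E).mulVec x) = lam * φ x) (hlam : Valued.v lam = 1)
    (hform : ∀ x y, jE (pairing σ H₂ x y) = h * Θ (φ x) * φ y + ρ (h * Θ (φ x) * φ y))
    (hMfin : {Λ : AddSubgroup M | (∃ z c : M, z ≠ 0 ∧ ρ c = c ∧ c ≠ 0 ∧ Valued.v c ≤ 1 ∧ ∀ x, x ∈ Λ ↔ ∃ y, IsOrd ρ α c y ∧ x = z * y) ∧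
        (∀ x ∈ Λ, lam * x ∈ Λ) ∧ (∀ m, (∀ a ∈ Λ, Valued.v (h * Θ a * m + ρ (h * Θ a * m)) ≤ 1) ↔ m ∈ Λ)}.Finite) :
    {B : Submodule 𝒪[E] (Fin 2 → E) | IsSelfDualLattice σ ϖ H₂ B ∧ mapGL γ₂ B = B}.Finite := by
  refine Set.Finite.of_finite_image (hMfin.subset ?_) fun B _ B' _ hBB' => map_toAddSubgroup_injective φ hφi hBB'
  rintro Λ ⟨B, ⟨hSD, hfix⟩, rfl⟩
  have hdual : dualLatt σ H₂ B = B := dualLatt_eq_self_of_isSelfDualLattice hvσ hH₂ hSD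
  obtain ⟨g, hBg, -, -, -⟩ := hSD
  subst hBg
  refine ⟨?_, ?_, ?_⟩
  · exact exists_eq_mul_order_map_latt jE hρρ hα hα1 hint hjv hjfix φ hφs hφi g
  · exact (mapGL_eq_iff_forall_mul_mem jE hρρ hvρ hα hα1 hint hjv hjfix φ hφs hφi hφγ hlam g).1 hfix
  · exact forall_herm_iff_mem_of_dualLatt_eq σ H₂ jE ρ Θ h hjv φ hφi hφo hform hdual

/-! ## §3 A canonical weight -/

/-- **§3 A CHOICE-FREE WEIGHT.**  In the letters of ★ (C1) (block `ι-shape(H₂, h_W)`, `𝒪_E` a PID, line model `(φ, lam, h)` with the value dictionary), for every `u : E` there is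
`f : ℕ → ℕ → AddSubgroup M → ℕ` with the `hf` property of ★ (C1) ∕ ★ (β) VERBATIM: on every cone cell `Λ = x₀·𝒪_j ∈ levelSetDep(j, b; lam − jE u)` presented by a
generator `x₀` with `lam ∈ 𝒪_j` and `jE r = glueUnit(x₀, b)`, `f b j Λ = Nat.card Sol_{2b}(r)`.  Construction: `f b j Λ :=` the number of self-dual block lattices gluing
(a choice of) the `φ`-preimage lattice of `Λ` at tube coordinate `b` (`0` if `Λ` has no preimage lattice); the value is `Nat.card Sol_{2b}(r)` for EVERY presentation by ★
`ncard_glueFibre_eq_natCard_normFibre_of_gen` (LH4-p12 (g4)), a preimage lattice existing by ★ `exists_latt_map_eq_of_order`. [cite: Jacobowitz1962, §4]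
[cite: BruhatTits1972, §10] [cite: Kottwitz1986BaseChangeUnits, §1 pp. 240–241] -/
theorem exists_weight [IsPrincipalIdealRing 𝒪[E]] (σ : E →+* E) (hσ : ∀ a, σ (σ a) = a) (hvσ : ∀ a, Valued.v (σ a) = Valued.v a)
    {ϖ : E} (hϖ : Valued.v ϖ = WithZero.exp (-1 : ℤ))
    {H₂ : Matrix (Fin 2) (Fin 2) E} (hH₂ : IsUnit H₂.det) (hH₂σ : (H₂.map σ)ᵀ = H₂) {hW : E} (hhW : Valued.v hW = 1) (hhWσ : σ hW = hW) (jE : E →+* M)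
    (hρρ : ∀ x, ρ (ρ x) = x) (hvρ : ∀ x, Valued.v (ρ x) = Valued.v x) (hα : ρ α ≠ α) (hα1 : Valued.v α ≤ 1)
    (hint : ∀ z : M, Valued.v z ≤ 1 → Valued.v ((z - ρ z) / (α - ρ α)) ≤ 1)
    (hΘΘ : ∀ x, Θ (Θ x) = x) (hΘρ : ∀ x, Θ (ρ x) = ρ (Θ x)) (hvΘ : ∀ x, Valued.v (Θ x) = Valued.v x) (hΘj : ∀ x, Θ (jE x) = jE (σ x))
    (hjv : ∀ c, Valued.v (jE c) ≤ 1 ↔ Valued.v c ≤ 1) (hjfix : ∀ z, ρ z = z ↔ ∃ c, jE c = z)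
    (hjpow : ∀ (t : E) (n : ℤ), Valued.v (jE t) = Valued.v (jE ϖ) ^ n ↔ Valued.v t = Valued.v ϖ ^ n)
    (hϖmax : ∀ t : M, ρ t = t → Valued.v t < 1 → Valued.v t ≤ Valued.v (jE ϖ))
    (φ : (Fin 2 → E) →+ M) (hφs : ∀ (c : E) (x : Fin 2 → E), φ (c • x) = jE c * φ x) (hφi : Function.Injective φ) (hφo : Function.Surjective φ)
    {γ₂ : GL (Fin 2) E} {lam h : M} (hφγ : ∀ x, φ ((γ₂ : Matrix (Fin 2) (Fin 2) E).mulVec x) = lam * φ x) (hlam : Valued.v lam = 1)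
    (hΘh : Θ h = h) (hh : h ≠ 0) (hform : ∀ x y, jE (pairing σ H₂ x y) = h * Θ (φ x) * φ y + ρ (h * Θ (φ x) * φ y)) (u : E) :
    ∃ f : ℕ → ℕ → AddSubgroup M → ℕ,
      ∀ (b j : ℕ) (Λ : AddSubgroup M) (x₀ : M) (r : E), 1 ≤ b → x₀ ≠ 0 →
        (∀ x, x ∈ Λ ↔ ∃ z, IsOrd ρ α (jE ϖ ^ j) z ∧ x = x₀ * z) →
        IsOrd ρ α (jE ϖ ^ j) (dualGen ρ Θ α (jE ϖ ^ j) h x₀) → ¬ IsOrd ρ α (jE ϖ ^ j) (dualGen ρ Θ α (jE ϖ ^ j) h x₀ / jE ϖ) →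
        Valued.v (dualGen ρ Θ α (jE ϖ ^ j) h x₀) = Valued.v (jE ϖ) ^ b →
        (∀ b', (∀ x ∈ Λ, Valued.v (h * Θ x * b' + ρ (h * Θ x * b')) ≤ 1) → (lam - jE u) * b' ∈ Λ) →
        IsOrd ρ α (jE ϖ ^ j) lam → jE r = glueUnit ρ Θ α (jE ϖ ^ j) h (jE ϖ) (jE hW) x₀ b →
        f b j Λ = Nat.card {x : 𝒪[E] ⧸ 𝓂[E] ^ (2 * b) // ∃ u' : 𝒪[E], Ideal.Quotient.mk (𝓂[E] ^ (2 * b)) u' = x ∧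
          Valued.v ((u' : E) * σ u' - r) ≤ Valued.v (ϖ ^ (2 * b))} := by
  classical
  refine ⟨fun b j Λ => if hB : ∃ B₂ : Submodule 𝒪[E] (Fin 2 → E), B₂.toAddSubgroup.map φ = Λ then
      {L : Submodule 𝒪[E] (Fin 3 → E) | IsSelfDualLattice σ ϖ (!![H₂ 0 0, 0, H₂ 0 1; 0, hW, 0; H₂ 1 0, 0, H₂ 1 1] : Matrix (Fin 3) (Fin 3) E) L ∧
        L ⊓ LinearMap.ker ((LinearMap.proj (1 : Fin 3) : (Fin 3 → E) →ₗ[E] E).restrictScalars 𝒪[E]) =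
          hB.choose.map ((Matrix.toLin' (!![1, 0; 0, 0; 0, 1] : Matrix (Fin 3) (Fin 2) E)).restrictScalars 𝒪[E]) ∧
        ∀ c : E, (Pi.single 1 c : Fin 3 → E) ∈ L ↔ Valued.v c ≤ Valued.v ϖ ^ b}.ncard else 0, ?_⟩
  intro b j Λ x₀ r hb hx₀ hΛx hyO hyprim hylev hdepΛ hlamj hr
  have hc : ρ (jE ϖ ^ j) = jE ϖ ^ j := (hjfix _).2 ⟨ϖ ^ j, by rw [map_pow]⟩
  have hϖ0 : ϖ ≠ 0 := fun h0 => by rw [h0, map_zero] at hϖ; exact WithZero.coe_ne_zero.symm hϖ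
  have hjϖ0 : jE ϖ ^ j ≠ 0 := pow_ne_zero j (by rw [map_ne_zero_iff jE jE.injective]; exact hϖ0)
  have hjϖ1 : Valued.v (jE ϖ ^ j) ≤ 1 := by
    rw [← map_pow, hjv, map_pow, hϖ]; exact pow_le_one₀ zero_le (le_of_lt (by rw [← WithZero.exp_zero]; exact WithZero.exp_lt_exp.2 (by norm_num)))
  have hB : ∃ B₂ : Submodule 𝒪[E] (Fin 2 → E), B₂.toAddSubgroup.map φ = Λ := by
    obtain ⟨g, hg⟩ := exists_latt_map_eq_of_order jE hρρ hα hα1 hint hjv hjfix φ hφs hφo hx₀ hc hjϖ0 hjϖ1 (Λ := Λ) (fun x => hΛx x)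
    exact ⟨_, hg⟩
  dsimp only
  rw [dif_pos hB]
  have hB₂ : hB.choose.toAddSubgroup.map φ = Λ := hB.choose_spec
  exact ncard_glueFibre_eq_natCard_normFibre_of_gen σ hσ hvσ hϖ hH₂ hH₂σ hhW hhWσ jE hρρ hvρ hα hα1 hint hΘΘ hΘρ hvΘ hΘj hjv hjfix hjpow hϖmax φ hφs hφi hφo hφγ
    hlam hΘh hh hform u hb hx₀ (by rw [hB₂]; exact hΛx) hyO hyprim hylev (by rw [hB₂]; exact hdepΛ) hlamj hr

/-! ## §4 The conductor cut-off -/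

/-- **§4 THE CONDUCTOR CUT-OFF.**  If `ρ` is isometric, `|α| ≤ 1`, `|c| < 1` and `ρ lam ≠ lam`, then `lam ∉ 𝒪_{c^{J+1}}` for some `J : ℕ` (`|lam − ρlam| > 0` while
`|c^{J+1}(α − ρα)| → 0`; ★ `exists_pow_lt₀`).  The `hJ` letter of ★ (C1) ∕ ★ W4. [cite: Jacobowitz1962, §4] [cite: Kottwitz1986BaseChangeUnits, §1 pp. 240–241] -/
theorem exists_not_isOrd_pow (hvρ : ∀ x, Valued.v (ρ x) = Valued.v x) (hα1 : Valued.v α ≤ 1) {c : M} (hc1 : Valued.v c < 1)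
    {lam : M} (hlam : ρ lam ≠ lam) : ∃ J : ℕ, ¬ IsOrd ρ α (c ^ (J + 1)) lam := by
  have hne : lam - ρ lam ≠ 0 := sub_ne_zero.2 (Ne.symm hlam)
  have hv0 : Valued.v (lam - ρ lam) ≠ 0 := (Valuation.ne_zero_iff _).2 hne
  obtain ⟨n, hn⟩ := exists_pow_lt₀ hc1 (Units.mk0 _ hv0)
  refine ⟨n, fun hord => ?_⟩
  have h2 := hord.2
  have hαρ : Valued.v (α - ρ α) ≤ 1 := by
    refine (Valuation.map_sub _ _ _).trans (max_le hα1 ?_); rw [hvρ]; exact hα1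
  have : Valued.v (lam - ρ lam) < Valued.v (lam - ρ lam) :=
    calc Valued.v (lam - ρ lam) ≤ Valued.v (c ^ (n + 1) * (α - ρ α)) := h2
      _ = Valued.v c ^ (n + 1) * Valued.v (α - ρ α) := by rw [map_mul, map_pow]
      _ ≤ Valued.v c ^ n * 1 := by
          refine mul_le_mul' ?_ hαρ
          rw [pow_succ]; exact mul_le_of_le_one_right' hc1.le
      _ = Valued.v c ^ n := mul_one _
      _ < Valued.v (lam - ρ lam) := hn
  exact lt_irrefl _ this

end Summit.HodgeConjecture.HodgeConjecture.Cruxes.H413.F0P3cDyRamFixedPointCensusTypeTwoFiniteness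

end
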